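import Mathlib.NumberTheory.ModularForms.Derivative
import Mathlib.NumberTheory.ModularForms.Basic
import Mathlib.NumberTheory.ModularForms.EisensteinSeries.E2.Summable
import Mathlib.Analysis.Complex.Liouville
import HarnessLib

/-!
# The Serre derivative of a modular form is a modular form

Mathlib (`ModularForms/Derivative.lean`) defines `D = (2πi)⁻¹ d/dτ` and the Serre derivative
`ϑ_k f = D f − (k/12) E₂ f`, and proves its slash-equivariance
`(ϑ_k f)|_{k+2} γ = ϑ_k (f|_k γ)` for `γ ∈ SL₂(ℤ)` (`serreDerivative_slash_equivariant`), leaving as a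
TODO that "the Serre derivative preserves modularity, `ϑ_k(M_k) ⊆ M_{k+2}`". This file supplies it
for arithmetic subgroups whose elements come from `SL₂(ℤ)` — in particular `Γ₀(N)`
(`serreDerivativeGamma0 : ModularForm (Gamma0 N) k → ModularForm (Gamma0 N) (k+2)`):

* invariance: `serreDerivative_slash_invariant`;
* holomorphy: `serreDerivative_mdifferentiable`;
* boundedness at every cusp: `(ϑf)|γ = ϑ(f|γ) = D(f|γ) − (k/12)E₂·(f|γ)` with `f|γ` bounded at `i∞`
  (`ModularFormClass.bdd_at_infty_slash`), `E₂` bounded at `i∞`, and — the one analytic input —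
  **`D g` is bounded at `i∞` whenever the holomorphic `g` is** (`isBoundedAtImInfty_D_of_bounded`,
  Cauchy's estimate on discs of radius `1`: `|g′(τ)| ≤ sup_{|w−τ|=1}|g(w)|`).

Used for the level-6 identities behind the Chan–Zudilin parametrisation of the Domb series
(`ϑZ`, `ϑg` as genuine forms so that Sturm's bound applies).

## References

* D. Zagier, *Elliptic modular forms and their applications* (2008), §5.1, Prop. 15 and (53)
  (`ϑ_k : M_k → M_{k+2}`). [Zagier2008]
-/

noncomputable section

open UpperHalfPlane hiding I
open Complex Filter Topology Asymptotics ModularForm Derivative EisensteinSeries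
open scoped Real MatrixGroups ModularForm Manifold

namespace Literature.NumberTheory.ModularForms

/-! ### `D` preserves boundedness at `i∞` (Cauchy's estimate) -/

/-- **If `g : ℍ → ℂ` is holomorphic and bounded at `i∞`, so is `D g`.** For `Im τ ≥ A + 2` the closed
unit disc around `τ` lies in `{Im > A}` where `‖g‖ ≤ M`, so `‖(g ∘ ofComplex)′(τ)‖ ≤ M`.
[cite: Zagier2008, §5.1] -/
theorem isBoundedAtImInfty_D_of_bounded {g : ℍ → ℂ} (hhol : MDiff g) (hbdd : IsBoundedAtImInfty g) :
    IsBoundedAtImInfty (D g) := by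
  rw [UpperHalfPlane.isBoundedAtImInfty_iff] at hbdd ⊢
  obtain ⟨M, A, hM⟩ := hbdd
  have hdiff : DifferentiableOn ℂ (g ∘ ofComplex) {z : ℂ | 0 < z.im} :=
    UpperHalfPlane.mdifferentiable_iff.mp hhol
  refine ⟨‖(2 * π * I : ℂ)⁻¹‖ * (max M 0 / 1), max A 0 + 2, fun τ hτ => ?_⟩
  have hτ2 : (2 : ℝ) ≤ τ.im := by linarith [le_max_right A 0]
  -- the closed unit disc around `τ` lies in `{Im w > max A 0 + 1/2}` hence in `ℍ` and in `{Im ≥ A}`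
  have hball : ∀ w ∈ Metric.closedBall (τ : ℂ) 1, max A 0 + 1 ≤ w.im := by
    intro w hw
    have hdist : dist w (τ : ℂ) ≤ 1 := Metric.mem_closedBall.mp hw
    have him : |w.im - (τ : ℂ).im| ≤ 1 :=
      (Complex.abs_im_le_norm (w - τ)).trans (by simpa [dist_eq_norm] using hdist)
    have hτim : (τ : ℂ).im = τ.im := rfl
    rw [hτim] at him
    have := abs_le.mp him
    linarith
  have hsub : Metric.closedBall (τ : ℂ) 1 ⊆ {z : ℂ | 0 < z.im} := fun w hw => by
    have := hball w hw
    simp only [Set.mem_setOf_eq]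
    linarith [le_max_right A 0]
  have hdc : DiffContOnCl ℂ (g ∘ ofComplex) (Metric.ball (τ : ℂ) 1) := by
    refine DifferentiableOn.diffContOnCl ?_
    rw [closure_ball _ one_ne_zero]
    exact hdiff.mono hsub
  have hC : ∀ w ∈ Metric.sphere (τ : ℂ) 1, ‖(g ∘ ofComplex) w‖ ≤ max M 0 := by
    intro w hw
    have hw' := hball w (Metric.sphere_subset_closedBall hw)
    have hwpos : 0 < w.im := by linarith [le_max_right A 0]
    simp only [Function.comp_apply, ofComplex_apply_of_im_pos hwpos]
    refine (hM ⟨w, hwpos⟩ ?_).trans (le_max_left _ _)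
    show A ≤ w.im
    linarith [le_max_left A 0, le_max_right A 0]
  have hderiv := Complex.norm_deriv_le_of_forall_mem_sphere_norm_le one_pos hdc hC
  show ‖(2 * π * I)⁻¹ * deriv (g ∘ ofComplex) τ‖ ≤ _
  rw [norm_mul]
  gcongr

/-! ### The Serre derivative of a modular form -/

/-- The Serre derivative of a modular form is bounded at `i∞` after slashing by any `γ ∈ SL₂(ℤ)`.
[cite: Zagier2008, §5.1] -/
theorem isBoundedAtImInfty_serreDerivative_slash {Γ : Subgroup (GL (Fin 2) ℝ)} [Γ.IsArithmetic]
    {k : ℤ} (f : ModularForm Γ k) (γ : SL(2, ℤ)) :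
    IsBoundedAtImInfty (serreDerivative k f ∣[k + 2] γ) := by
  rw [serreDerivative_slash_equivariant (ModularFormClass.holo f)]
  set G : ℍ → ℂ := (⇑f) ∣[k] γ with hG
  have hGhol : MDiff G := (ModularFormClass.holo f).slash k γ
  have hGbdd : IsBoundedAtImInfty G := ModularFormClass.bdd_at_infty_slash f γ
  have hD : IsBoundedAtImInfty (D G) := isBoundedAtImInfty_D_of_bounded hGhol hGbdd
  have hE : IsBoundedAtImInfty (fun z => (k : ℂ) * 12⁻¹ * E2 z * G z) := by
    have h0 := (isBoundedAtImInfty_E2.mul hGbdd).const_mul_left ((k : ℂ) * 12⁻¹)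
    have hfun : (fun z => (k : ℂ) * 12⁻¹ * E2 z * G z) = fun z => (k : ℂ) * 12⁻¹ * (E2 * G) z := by
      funext z; simp only [Pi.mul_apply]; ring
    rw [hfun]
    exact h0
  have hfun : serreDerivative k G = fun z => D G z - (k : ℂ) * 12⁻¹ * E2 z * G z := by
    funext z; rw [serreDerivative_apply]
  rw [hfun]
  exact hD.sub hE

/-- **The Serre derivative `ϑ_k f = Df − (k/12)E₂f` of `f ∈ M_k(Γ₀(N))` is a modular form of weight
`k + 2` on `Γ₀(N)`** (Mathlib's TODO in `ModularForms/Derivative.lean`, for `Γ₀(N)`).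
[cite: Zagier2008, §5.1 Prop. 15] -/
def serreDerivativeGamma0 (N : ℕ) [NeZero N] {k : ℤ} (f : ModularForm (CongruenceSubgroup.Gamma0 N) k) :
    ModularForm (CongruenceSubgroup.Gamma0 N) (k + 2) where
  toFun := serreDerivative k f
  slash_action_eq' A hA := by
    obtain ⟨γ, hγ, rfl⟩ := hA
    exact serreDerivative_slash_invariant (ModularFormClass.holo f)
      (SlashInvariantFormClass.slash_action_eq f γ ⟨γ, hγ, rfl⟩)
  holo' := serreDerivative_mdifferentiable k (ModularFormClass.holo f)
  bdd_at_cusps' hcusp := by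
    rw [Subgroup.IsArithmetic.isCusp_iff_isCusp_SL2Z] at hcusp
    rw [OnePoint.isBoundedAt_iff_forall_SL2Z hcusp]
    intro γ _
    exact isBoundedAtImInfty_serreDerivative_slash f γ

/-- The underlying function. [folklore] -/
theorem coe_serreDerivativeGamma0 (N : ℕ) [NeZero N] {k : ℤ} (f : ModularForm (CongruenceSubgroup.Gamma0 N) k) :
    (serreDerivativeGamma0 N f : ℍ → ℂ) = serreDerivative k f := rfl

/-- Pointwise: `(ϑf)(τ) = Df(τ) − (k/12) E₂(τ) f(τ)`. [folklore] -/
theorem serreDerivativeGamma0_apply (N : ℕ) [NeZero N] {k : ℤ} (f : ModularForm (CongruenceSubgroup.Gamma0 N) k)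
    (τ : ℍ) : serreDerivativeGamma0 N f τ = D f τ - k * 12⁻¹ * E2 τ * f τ := rfl

end Literature.NumberTheory.ModularForms

end
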